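import Mathlib.Algebra.MvPolynomial.PDeriv
import Mathlib.Algebra.MvPolynomial.Variables
import Mathlib.LinearAlgebra.Matrix.Determinant.Basic
import Mathlib.Data.Matrix.Block
import Mathlib.Logic.Equiv.Fin.Basic
import Literature.NumberTheory.Transcendental.EclPregeometry
import HarnessLib

/-!
# Kirby 2010, Lemma 3.3: `ecl C` is an E-subfield — proofs

Sibling proof file of `EclPregeometry.lean`. It DISCHARGES the named fact
`Literature.Kirby2010_ecl_isExpSubfield K` (for every field `K` with an E-ring structure):

> **Lemma 3.3** (J. Kirby, *Exponential algebraicity in exponential fields*, Bull. Lond. Math.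
> Soc. 42 (2010) 879–890, p. 4). If `R` is a partial E-domain then `ecl^R` is a closure operator
> with finite character. […] Furthermore, the closure of any subset is an E-subring of `R`, and,
> if `R` is a field, it is an E-subfield. *Proof.* A straightforward exercise.

as `Literature.NumberTheory.Transcendental.Kirby2010_ecl_isExpSubfield_holds`, by carrying out the exercise for the tree's
definition `Literature.NumberTheory.Transcendental.ecl` (`ZilberField.lean`: first coordinates of non-degenerate solutions of
Khovanskii systems `f₁(x̄, e^{x̄}) = ⋯ = fₙ(x̄, e^{x̄}) = 0`, `fᵢ ∈ ℤ[C][X̄, Ȳ]`,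
`det(∂fᵢ/∂xⱼ) ≠ 0`).

## The exercise

All closure properties follow from three constructions on Khovanskii systems, which we phrase
for systems indexed by an arbitrary finite type (`Khovanskii.IsSol`; the definition of `ecl` uses
`Fin n`, and `Khovanskii.mem_ecl_iff` transports along `Fintype.equivFin`):

* `IsSol.single`: one equation `p(x, eˣ) = 0` in one unknown with `∂p/∂x ≠ 0`;
* `IsSol.merge`: two systems in disjoint sets of unknowns `x̄`, `x̄'` form a system in
  `(x̄, x̄')` whose Jacobian is block-diagonal (`Matrix.det_fromBlocks_zero₁₂`);
* `IsSol.extend`: a system in `x̄` plus one more unknown `w` and one more equation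
  `p(x̄, w, e^{x̄}, e^{w}) = 0` with `∂p/∂w ≠ 0` at the point is a system in `(x̄, w)`
  (block-triangular Jacobian).

Then `0`, `1` (`X = 0`, `X − 1 = 0`), `a + b`, `a b` (merge the systems of `a = xᵢ` and `b = x'ₖ`,
extend by `w − xᵢ − x'ₖ`, `w − xᵢ x'ₖ`), `−a`, `a⁻¹` (`w + xᵢ`, `w xᵢ − 1` for `a ≠ 0`) and `eᵃ`
(`w − Yᵢ`, i.e. `w = e^{xᵢ}`; here `∂/∂w` of the exponential polynomial is `1`) all lie in
`ecl C`: `Khovanskii.eclSubfield C` is `ecl C` as a `Subfield K`, closed under `exp`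
(`Khovanskii.exp_mem_ecl`).

The bookkeeping of variables under renaming uses `MvPolynomial.pderiv_rename` (chain rule
commutes with injective renaming, `Khovanskii.ePD_rename`) and
`MvPolynomial.pderiv_eq_zero_of_notMem_vars` (equations of one block do not involve the unknowns
of the other, `Khovanskii.ePD_rename_of_notMem`). Coefficient conditions are handled through
the subring `Khovanskii.polyOver A σ` of polynomials with coefficients in `A`
(= range of `MvPolynomial.map A.subtype`).

No characteristic-zero hypothesis is needed for this part of Lemma 3.3 (Kirby's E-fields are of
characteristic zero by convention, p. 3).

## References

* J. Kirby, *Exponential algebraicity in exponential fields*, Bull. Lond. Math. Soc. 42 (2010),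
  879–890, doi:10.1112/blms/bdq044, arXiv:0810.4285: Def. 3.1–3.2, Lemma 3.3 (p. 4).
-/

noncomputable section

open MvPolynomial

namespace Literature.NumberTheory.Transcendental

namespace Khovanskii

variable {K : Type*} [Field K]

/-! ### Polynomials with coefficients in a subring -/

/-- The subring of polynomials over `K` in variables `σ` all of whose coefficients lie in the
subring `A ≤ K` (the range of `MvPolynomial.map A.subtype`). [folklore] -/
def polyOver (A : Subring K) (σ : Type*) : Subring (MvPolynomial σ K) :=
  (MvPolynomial.map A.subtype).range

/-- Membership in `polyOver A σ` is the coefficientwise condition. [folklore] -/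
theorem mem_polyOver_iff {A : Subring K} {σ : Type*} {p : MvPolynomial σ K} :
    p ∈ polyOver A σ ↔ ∀ m, p.coeff m ∈ A := by
  classical
  constructor
  · rintro ⟨q, rfl⟩ m
    rw [coeff_map]
    exact (q.coeff m).2
  · intro h
    show p ∈ Set.range (MvPolynomial.map A.subtype)
    rw [mem_range_map_iff_coeffs_subset]
    intro c hc
    obtain ⟨m, -, rfl⟩ := mem_coeffs_iff.mp hc
    exact ⟨⟨_, h m⟩, rfl⟩

/-- Variables have coefficients in any subring. [folklore] -/
theorem X_mem_polyOver (A : Subring K) {σ : Type*} (s : σ) :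
    (X s : MvPolynomial σ K) ∈ polyOver A σ :=
  ⟨X s, map_X _ _⟩

/-- Constants from `A` have coefficients in `A`. [folklore] -/
theorem C_mem_polyOver {A : Subring K} {σ : Type*} {a : K} (ha : a ∈ A) :
    (C a : MvPolynomial σ K) ∈ polyOver A σ :=
  ⟨C ⟨a, ha⟩, map_C _ _⟩

/-- Renaming variables preserves the coefficient condition (`MvPolynomial.map_rename`).
[folklore] -/
theorem rename_mem_polyOver {A : Subring K} {σ τ : Type*} (g : σ → τ) {p : MvPolynomial σ K}
    (hp : p ∈ polyOver A σ) : rename g p ∈ polyOver A τ := by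
  obtain ⟨q, rfl⟩ := hp
  exact ⟨rename g q, (map_rename _ _ _)⟩

/-! ### Khovanskii systems indexed by an arbitrary finite type -/

/-- `∂/∂xⱼ` of `f(x̄, e^{x̄})` by the chain rule, `∂f/∂Xⱼ + Yⱼ ∂f/∂Yⱼ` (`Literature.NumberTheory.Transcendental.expPDeriv` for an
arbitrary index type; Kirby 2010, Def. 3.1). [cite: Kirby2010, Def. 3.1] -/
def ePD {ι : Type*} (j : ι) (f : MvPolynomial (ι ⊕ ι) K) : MvPolynomial (ι ⊕ ι) K :=
  pderiv (Sum.inl j) f + X (Sum.inr j) * pderiv (Sum.inr j) f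

/-- The exponential partial derivative commutes with an injective renaming of the unknowns
(`MvPolynomial.pderiv_rename`). [folklore] -/
theorem ePD_rename {ι κ : Type*} {φ : ι → κ} (hφ : Function.Injective φ) (j : ι)
    (p : MvPolynomial (ι ⊕ ι) K) :
    ePD (φ j) (rename (Sum.map φ φ) p) = rename (Sum.map φ φ) (ePD j p) := by
  have hinj : Function.Injective (Sum.map φ φ) := Sum.map_injective.mpr ⟨hφ, hφ⟩
  rw [ePD, ePD, show (Sum.inl (φ j) : κ ⊕ κ) = Sum.map φ φ (Sum.inl j) from rfl,
    show (Sum.inr (φ j) : κ ⊕ κ) = Sum.map φ φ (Sum.inr j) from rfl,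
    pderiv_rename hinj, pderiv_rename hinj, map_add, map_mul, rename_X]

/-- A renamed polynomial has zero exponential partial derivative in every unknown outside the
range of the renaming. [folklore] -/
theorem ePD_rename_of_notMem {ι κ : Type*} (φ : ι → κ) {l : κ} (hl : l ∉ Set.range φ)
    (p : MvPolynomial (ι ⊕ ι) K) :
    ePD l (rename (Sum.map φ φ) p) = 0 := by
  classical
  have h1 : Sum.inl l ∉ (rename (Sum.map φ φ) p).vars := by
    intro h
    have := vars_rename _ _ h
    simp only [Finset.mem_image] at this
    obtain ⟨s, -, hs⟩ := this
    rcases s with i | i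
    · exact hl ⟨i, Sum.inl_injective hs⟩
    · exact Sum.inr_ne_inl hs
  have h2 : Sum.inr l ∉ (rename (Sum.map φ φ) p).vars := by
    intro h
    have := vars_rename _ _ h
    simp only [Finset.mem_image] at this
    obtain ⟨s, -, hs⟩ := this
    rcases s with i | i
    · exact Sum.inl_ne_inr hs
    · exact hl ⟨i, Sum.inr_injective hs⟩
  rw [ePD, pderiv_eq_zero_of_notMem_vars h1, pderiv_eq_zero_of_notMem_vars h2, mul_zero, add_zero]

variable [Literature.ModelTheory.ExponentialFields.ExponentialRing K]

/-- The point `(x̄, exp x̄) ∈ K^{ι ⊕ ι}` at which Khovanskii systems are evaluated.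
[cite: Kirby2010, Def. 3.1] -/
def kpt {ι : Type*} (x : ι → K) : ι ⊕ ι → K :=
  Sum.elim x (Literature.ModelTheory.ExponentialFields.ExponentialRing.exp ∘ x)

/-- The Jacobian matrix `(∂fᵢ/∂xⱼ)(x̄, e^{x̄})` of a Khovanskii system.
[cite: Kirby2010, Def. 3.1] -/
def kjac {ι : Type*} (x : ι → K) (f : ι → MvPolynomial (ι ⊕ ι) K) : Matrix ι ι K :=
  Matrix.of fun i j => eval (kpt x) (ePD j (f i))

/-- `x̄` is a solution of the Khovanskii system `f̄` over `C` (indexed by a finite type `ι`):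
coefficients in the subring generated by `C`, `fᵢ(x̄, e^{x̄}) = 0` for all `i`, and non-vanishing
Jacobian `det (∂fᵢ/∂xⱼ)(x̄, e^{x̄}) ≠ 0`. For `ι = Fin n` this is literally the body of `Literature.NumberTheory.Transcendental.ecl`.
[cite: Kirby2010, Def. 3.1–3.2] -/
structure IsSol (C : Set K) {ι : Type*} [Fintype ι] [DecidableEq ι] (x : ι → K)
    (f : ι → MvPolynomial (ι ⊕ ι) K) : Prop where
  coeff : ∀ i, f i ∈ polyOver (Subring.closure C) (ι ⊕ ι)
  eval_eq : ∀ i, eval (kpt x) (f i) = 0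
  det_ne : (kjac x f).det ≠ 0

/-! ### Renaming variables -/

/-- Renaming the unknowns of the point `(x̄, e^{x̄})`. [folklore] -/
theorem kpt_comp_map {ι κ : Type*} (x : κ → K) (φ : ι → κ) :
    kpt x ∘ Sum.map φ φ = kpt (x ∘ φ) := by
  funext s; rcases s with i | i <;> rfl

/-- Jacobian entries are unchanged under injective renaming. [folklore] -/
theorem eval_ePD_rename {ι κ : Type*} (x : κ → K) {φ : ι → κ} (hφ : Function.Injective φ)
    (j : ι) (p : MvPolynomial (ι ⊕ ι) K) :
    eval (kpt x) (ePD (φ j) (rename (Sum.map φ φ) p)) = eval (kpt (x ∘ φ)) (ePD j p) := by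
  rw [ePD_rename hφ, eval_rename, kpt_comp_map]

/-- Values are unchanged under renaming. [folklore] -/
theorem eval_rename_map {ι κ : Type*} (x : κ → K) (φ : ι → κ) (p : MvPolynomial (ι ⊕ ι) K) :
    eval (kpt x) (rename (Sum.map φ φ) p) = eval (kpt (x ∘ φ)) p := by
  rw [eval_rename, kpt_comp_map]

/-! ### Transport along a bijection of index types -/

/-- Transport of a Khovanskii solution along a bijection of index types (the Jacobian is
reindexed, `Matrix.det_reindex_self`). [folklore] -/
theorem IsSol.transport {C : Set K} {ι κ : Type*} [Fintype ι] [DecidableEq ι] [Fintype κ]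
    [DecidableEq κ] (e : ι ≃ κ) {x : ι → K} {f : ι → MvPolynomial (ι ⊕ ι) K}
    (h : IsSol C x f) :
    IsSol C (x ∘ e.symm) (fun k => rename (Sum.map e e) (f (e.symm k))) where
  coeff k := rename_mem_polyOver _ (h.coeff _)
  eval_eq k := by rw [eval_rename_map, Function.comp_assoc, e.symm_comp_self, Function.comp_id,
    h.eval_eq]
  det_ne := by
    have : kjac (x ∘ e.symm) (fun k => rename (Sum.map e e) (f (e.symm k))) =
        Matrix.reindex e e (kjac x f) := by
      ext k l
      simp only [kjac, Matrix.reindex_apply, Matrix.submatrix_apply, Matrix.of_apply]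
      conv_lhs => rw [← e.apply_symm_apply l]
      rw [eval_ePD_rename _ e.injective, Function.comp_assoc, e.symm_comp_self, Function.comp_id]
    rw [this, Matrix.det_reindex_self]
    exact h.det_ne

/-- Membership in `ecl C` via Khovanskii systems indexed by any finite type (transport to `Fin n`
along `Fintype.equivFin`). [cite: Kirby2010, Def. 3.2] -/
theorem mem_ecl_iff {C : Set K} {a : K} :
    a ∈ ecl C ↔ ∃ (ι : Type) (_ : Fintype ι) (_ : DecidableEq ι) (x : ι → K)
      (f : ι → MvPolynomial (ι ⊕ ι) K), IsSol C x f ∧ ∃ i, x i = a := by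
  constructor
  · rintro ⟨n, x, f, hxa, hcoeff, heval, hdet⟩
    exact ⟨Fin n, inferInstance, inferInstance, x, f,
      ⟨fun i => mem_polyOver_iff.mpr (hcoeff i), heval, hdet⟩, hxa⟩
  · rintro ⟨ι, _, _, x, f, h, i, rfl⟩
    have h' := h.transport (Fintype.equivFin ι)
    refine ⟨Fintype.card ι, _, _, ⟨Fintype.equivFin ι i, by simp⟩,
      fun k => mem_polyOver_iff.mp (h'.coeff k), h'.eval_eq, ?_⟩
    exact h'.det_ne

/-- First half of the point: `x̄`. [folklore] -/
@[simp] theorem kpt_inl {ι : Type*} (x : ι → K) (i : ι) : kpt x (Sum.inl i) = x i := rfl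

/-- Second half of the point: `e^{x̄}`. [folklore] -/
@[simp] theorem kpt_inr {ι : Type*} (x : ι → K) (i : ι) :
    kpt x (Sum.inr i) = Literature.ModelTheory.ExponentialFields.ExponentialRing.exp (x i) := rfl

/-! ### One equation in one unknown -/

/-- One equation in one unknown with non-zero derivative is a Khovanskii system
(`Matrix.det_unique`). [cite: Kirby2010, Lemma 3.3] -/
theorem IsSol.single {C : Set K} (c : K) (p : MvPolynomial (Unit ⊕ Unit) K)
    (hp : p ∈ polyOver (Subring.closure C) (Unit ⊕ Unit))
    (hpc : eval (kpt fun _ : Unit => c) p = 0)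
    (hpd : eval (kpt fun _ : Unit => c) (ePD () p) ≠ 0) :
    IsSol C (fun _ : Unit => c) (fun _ => p) where
  coeff _ := hp
  eval_eq _ := hpc
  det_ne := by rwa [Matrix.det_unique]

/-! ### Merging two systems (block-diagonal Jacobian) -/

/-- Two Khovanskii systems in disjoint unknowns merge into one, with block-diagonal Jacobian
(`Matrix.det_fromBlocks_zero₁₂`). [cite: Kirby2010, Lemma 3.3] -/
theorem IsSol.merge {C : Set K} {ι κ : Type*} [Fintype ι] [DecidableEq ι] [Fintype κ]
    [DecidableEq κ] {x : ι → K} {f : ι → MvPolynomial (ι ⊕ ι) K} {x' : κ → K}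
    {g : κ → MvPolynomial (κ ⊕ κ) K} (h : IsSol C x f) (h' : IsSol C x' g) :
    IsSol C (Sum.elim x x')
      (Sum.elim (fun i => rename (Sum.map Sum.inl Sum.inl) (f i))
        (fun k => rename (Sum.map Sum.inr Sum.inr) (g k))) where
  coeff s := by
    rcases s with i | k
    · exact rename_mem_polyOver _ (h.coeff i)
    · exact rename_mem_polyOver _ (h'.coeff k)
  eval_eq s := by
    rcases s with i | k
    · simp only [Sum.elim_inl]
      rw [eval_rename_map, Sum.elim_comp_inl, h.eval_eq]
    · simp only [Sum.elim_inr]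
      rw [eval_rename_map, Sum.elim_comp_inr, h'.eval_eq]
  det_ne := by
    have : kjac (Sum.elim x x') (Sum.elim (fun i => rename (Sum.map Sum.inl Sum.inl) (f i))
        (fun k => rename (Sum.map Sum.inr Sum.inr) (g k))) =
        Matrix.fromBlocks (kjac x f) 0 0 (kjac x' g) := by
      ext s t
      rcases s with i | k <;> rcases t with j | l
      · simp only [kjac, Matrix.of_apply, Matrix.fromBlocks_apply₁₁, Sum.elim_inl]
        rw [eval_ePD_rename _ Sum.inl_injective, Sum.elim_comp_inl]
      · simp only [kjac, Matrix.of_apply, Matrix.fromBlocks_apply₁₂, Sum.elim_inl,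
          Matrix.zero_apply]
        rw [ePD_rename_of_notMem Sum.inl (by rintro ⟨_, h⟩; cases h), map_zero]
      · simp only [kjac, Matrix.of_apply, Matrix.fromBlocks_apply₂₁, Sum.elim_inr,
          Matrix.zero_apply]
        rw [ePD_rename_of_notMem Sum.inr (by rintro ⟨_, h⟩; cases h), map_zero]
      · simp only [kjac, Matrix.of_apply, Matrix.fromBlocks_apply₂₂, Sum.elim_inr]
        rw [eval_ePD_rename _ Sum.inr_injective, Sum.elim_comp_inr]
    rw [this, Matrix.det_fromBlocks_zero₁₂]
    exact mul_ne_zero h.det_ne h'.det_ne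

/-! ### Adding one unknown and one equation (block-triangular Jacobian) -/

/-- A Khovanskii system in `x̄` extended by one unknown `w` and one equation `p = 0` with
`∂p/∂w ≠ 0` at `(x̄, w)` is a Khovanskii system (block-triangular Jacobian).
[cite: Kirby2010, Lemma 3.3] -/
theorem IsSol.extend {C : Set K} {ι : Type*} [Fintype ι] [DecidableEq ι] {x : ι → K}
    {f : ι → MvPolynomial (ι ⊕ ι) K} (h : IsSol C x f) (c : K)
    (p : MvPolynomial ((ι ⊕ Unit) ⊕ (ι ⊕ Unit)) K)
    (hp : p ∈ polyOver (Subring.closure C) ((ι ⊕ Unit) ⊕ (ι ⊕ Unit)))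
    (hpc : eval (kpt (Sum.elim x fun _ : Unit => c)) p = 0)
    (hpd : eval (kpt (Sum.elim x fun _ : Unit => c)) (ePD (Sum.inr ()) p) ≠ 0) :
    IsSol C (Sum.elim x fun _ : Unit => c)
      (Sum.elim (fun i => rename (Sum.map Sum.inl Sum.inl) (f i)) fun _ => p) where
  coeff s := by
    rcases s with i | u
    · exact rename_mem_polyOver _ (h.coeff i)
    · exact hp
  eval_eq s := by
    rcases s with i | u
    · simp only [Sum.elim_inl]
      rw [eval_rename_map, Sum.elim_comp_inl, h.eval_eq]
    · exact hpc
  det_ne := by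
    set X' : ι ⊕ Unit → K := Sum.elim x fun _ : Unit => c
    have : kjac X' (Sum.elim (fun i => rename (Sum.map Sum.inl Sum.inl) (f i)) fun _ => p) =
        Matrix.fromBlocks (kjac x f) 0
          (Matrix.of fun (_ : Unit) j => eval (kpt X') (ePD (Sum.inl j) p))
          (Matrix.of fun (_ : Unit) (_ : Unit) => eval (kpt X') (ePD (Sum.inr ()) p)) := by
      ext s t
      rcases s with i | u <;> rcases t with j | v
      · simp only [kjac, Matrix.of_apply, Matrix.fromBlocks_apply₁₁, Sum.elim_inl]
        rw [eval_ePD_rename _ Sum.inl_injective, Sum.elim_comp_inl]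
      · simp only [kjac, Matrix.of_apply, Matrix.fromBlocks_apply₁₂, Sum.elim_inl,
          Matrix.zero_apply]
        rw [ePD_rename_of_notMem Sum.inl (by rintro ⟨_, h⟩; cases h), map_zero]
      · simp only [kjac, Matrix.of_apply, Matrix.fromBlocks_apply₂₁, Sum.elim_inr]
      · simp only [kjac, Matrix.of_apply, Matrix.fromBlocks_apply₂₂, Sum.elim_inr]
    rw [this, Matrix.det_fromBlocks_zero₁₂]
    refine mul_ne_zero h.det_ne ?_
    rw [Matrix.det_unique]
    exact hpd

/-! ### Closure properties of `ecl C` (Kirby 2010, Lemma 3.3) -/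

section Closure

variable (C : Set K)

/-- `0 ∈ ecl C` (`X = 0`). [cite: Kirby2010, Lemma 3.3] -/
theorem zero_mem_ecl : (0 : K) ∈ ecl C := by
  classical
  rw [mem_ecl_iff]
  refine ⟨Unit, inferInstance, inferInstance, fun _ => 0, fun _ => X (Sum.inl ()),
    IsSol.single 0 _ (X_mem_polyOver _ _) (by simp) ?_, (), rfl⟩
  simp [ePD, pderiv_X]

/-- `1 ∈ ecl C` (`X − 1 = 0`). [cite: Kirby2010, Lemma 3.3] -/
theorem one_mem_ecl : (1 : K) ∈ ecl C := by
  classical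
  rw [mem_ecl_iff]
  refine ⟨Unit, inferInstance, inferInstance, fun _ => 1, fun _ => X (Sum.inl ()) - 1,
    IsSol.single 1 _ (sub_mem (X_mem_polyOver _ _) (one_mem _)) (by simp) ?_, (), rfl⟩
  simp [ePD, pderiv_X]

variable {C}

/-- `ecl C` is closed under addition (merge, then `w − xᵢ − x'ₖ = 0`).
[cite: Kirby2010, Lemma 3.3] -/
theorem add_mem_ecl {a b : K} (ha : a ∈ ecl C) (hb : b ∈ ecl C) : a + b ∈ ecl C := by
  classical
  rw [mem_ecl_iff] at ha hb ⊢
  obtain ⟨ι, _, _, x, f, hx, i₀, rfl⟩ := ha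
  obtain ⟨κ, _, _, x', g, hx', k₀, rfl⟩ := hb
  refine ⟨(ι ⊕ κ) ⊕ Unit, inferInstance, inferInstance, _, _,
    (hx.merge hx').extend (x i₀ + x' k₀)
      (X (Sum.inl (Sum.inr ())) - X (Sum.inl (Sum.inl (Sum.inl i₀))) -
        X (Sum.inl (Sum.inl (Sum.inr k₀))))
      (sub_mem (sub_mem (X_mem_polyOver _ _) (X_mem_polyOver _ _)) (X_mem_polyOver _ _))
      (by simp) (by simp [ePD, pderiv_X]), Sum.inr (), rfl⟩

/-- `ecl C` is closed under negation (`w + xᵢ = 0`). [cite: Kirby2010, Lemma 3.3] -/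
theorem neg_mem_ecl {a : K} (ha : a ∈ ecl C) : -a ∈ ecl C := by
  classical
  rw [mem_ecl_iff] at ha ⊢
  obtain ⟨ι, _, _, x, f, hx, i₀, rfl⟩ := ha
  refine ⟨ι ⊕ Unit, inferInstance, inferInstance, _, _,
    hx.extend (-x i₀) (X (Sum.inl (Sum.inr ())) + X (Sum.inl (Sum.inl i₀)))
      (add_mem (X_mem_polyOver _ _) (X_mem_polyOver _ _))
      (by simp) (by simp [ePD, pderiv_X]), Sum.inr (), rfl⟩

/-- `ecl C` is closed under multiplication (merge, then `w − xᵢ x'ₖ = 0`).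
[cite: Kirby2010, Lemma 3.3] -/
theorem mul_mem_ecl {a b : K} (ha : a ∈ ecl C) (hb : b ∈ ecl C) : a * b ∈ ecl C := by
  classical
  rw [mem_ecl_iff] at ha hb ⊢
  obtain ⟨ι, _, _, x, f, hx, i₀, rfl⟩ := ha
  obtain ⟨κ, _, _, x', g, hx', k₀, rfl⟩ := hb
  refine ⟨(ι ⊕ κ) ⊕ Unit, inferInstance, inferInstance, _, _,
    (hx.merge hx').extend (x i₀ * x' k₀)
      (X (Sum.inl (Sum.inr ())) - X (Sum.inl (Sum.inl (Sum.inl i₀))) *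
        X (Sum.inl (Sum.inl (Sum.inr k₀))))
      (sub_mem (X_mem_polyOver _ _) (mul_mem (X_mem_polyOver _ _) (X_mem_polyOver _ _)))
      (by simp) (by simp [ePD, pderiv_X]), Sum.inr (), rfl⟩

/-- `ecl C` is closed under inversion (`w xᵢ − 1 = 0`, `∂/∂w = xᵢ = a ≠ 0`; `0⁻¹ = 0`).
[cite: Kirby2010, Lemma 3.3] -/
theorem inv_mem_ecl {a : K} (ha : a ∈ ecl C) : a⁻¹ ∈ ecl C := by
  classical
  rcases eq_or_ne a 0 with rfl | ha0
  · rw [inv_zero]; exact zero_mem_ecl C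
  rw [mem_ecl_iff] at ha ⊢
  obtain ⟨ι, _, _, x, f, hx, i₀, rfl⟩ := ha
  refine ⟨ι ⊕ Unit, inferInstance, inferInstance, _, _,
    hx.extend (x i₀)⁻¹ (X (Sum.inl (Sum.inr ())) * X (Sum.inl (Sum.inl i₀)) - 1)
      (sub_mem (mul_mem (X_mem_polyOver _ _) (X_mem_polyOver _ _)) (one_mem _))
      (by simp [inv_mul_cancel₀ ha0]) (by simpa [ePD, pderiv_X] using ha0), Sum.inr (), rfl⟩

/-- `ecl C` is closed under `exp` (`w − Yᵢ = 0`, i.e. `w = e^{xᵢ}`, with `∂/∂w = 1`).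
[cite: Kirby2010, Lemma 3.3] -/
theorem exp_mem_ecl {a : K} (ha : a ∈ ecl C) : Literature.ModelTheory.ExponentialFields.ExponentialRing.exp a ∈ ecl C := by
  classical
  rw [mem_ecl_iff] at ha ⊢
  obtain ⟨ι, _, _, x, f, hx, i₀, rfl⟩ := ha
  refine ⟨ι ⊕ Unit, inferInstance, inferInstance, _, _,
    hx.extend (Literature.ModelTheory.ExponentialFields.ExponentialRing.exp (x i₀)) (X (Sum.inl (Sum.inr ())) - X (Sum.inr (Sum.inl i₀)))
      (sub_mem (X_mem_polyOver _ _) (X_mem_polyOver _ _))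
      (by simp) (by simp [ePD, pderiv_X]), Sum.inr (), rfl⟩

variable (C)

/-- `ecl C` as a subfield of `K` (Kirby 2010, Lemma 3.3: "the closure of any subset is an
E-subring of `R`, and, if `R` is a field, it is an E-subfield"). [cite: Kirby2010, Lemma 3.3] -/
def eclSubfield : Subfield K where
  carrier := ecl C
  mul_mem' := mul_mem_ecl
  one_mem' := one_mem_ecl C
  add_mem' := add_mem_ecl
  zero_mem' := zero_mem_ecl C
  neg_mem' := neg_mem_ecl
  inv_mem' _ := inv_mem_ecl

/-- The carrier of `eclSubfield C` is `ecl C`. [cite: Kirby2010, Lemma 3.3] -/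
@[simp] theorem coe_eclSubfield : (eclSubfield C : Set K) = ecl C := rfl

end Closure

end Khovanskii

/-- **Discharge of `Kirby2010_ecl_isExpSubfield`** (Kirby 2010, Lemma 3.3: the closure of any subset
is an E-subfield). [cite: Kirby2010, Lemma 3.3] -/
theorem Kirby2010_ecl_isExpSubfield_holds (K : Type*) [Field K] [Literature.ModelTheory.ExponentialFields.ExponentialRing K] :
    Kirby2010_ecl_isExpSubfield K := fun C =>
  ⟨⟨Khovanskii.eclSubfield C, rfl⟩, fun _ ha => Khovanskii.exp_mem_ecl ha⟩

end Literature.NumberTheory.Transcendental
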